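import Literature.Analysis.FluidPDE.LerayFarFieldEpsilonRegularitySlab
import Literature.Analysis.FluidPDE.CKNEpsilonRegularityHolds
import Literature.Analysis.FluidPDE.JiaSverak2014EnergyStep
import Literature.Analysis.FluidPDE.LerayPressureDecayProofs
import Literature.Analysis.Potential.NewtonFarField
import HarnessLib

/-!
# Jia–Šverák 2014, proof of Thm. 3.1: boundedness of `u` near the initial time from the decay
  of the local energy of the perturbation (the ε-regularity criterion at the parabolic scale)

Analysis/FluidPDE proofs file (theorems only, no new definitions, no new named facts), part of
the proof of the named fact `Literature.Analysis.FluidPDE.jia_sverak_2014_theorem_3_2`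
(`JiaSverak2014LocalRegularity.lean`; H. Jia, V. Šverák, Invent. Math. 196 (2014) =
arXiv:1204.0529, §3 Thm. 3.2). The printed proof of Thm. 3.1 (arXiv p. 8) concludes the
`L^∞` bound `‖u‖_{L^∞(B_{1/2}(x₀)×(0,T₂))} ≤ C₁(α,γ,M)` from the smallness of the local energy
of `v = u - a` through the perturbed ε-regularity criterion of its §2 (Thm. 2.2). Here the
standard criterion is used instead (Lemarié-Rieusset 2016, Thm. 14.4 = the tree's proved fact
`lemarieRieusset_epsilon_regularity_holds`), on the parabolic cylinders `Q_ρ(t₀, y)`,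
`ρ = √t₀/2`, `y ∈ B_{1/2}(x₀)`: with `u = a + v`, `|a| ≤ 2A` and the decay
`E_v(t) ≤ Λ t^{3/2}` on `B_{3/1024}(y)` (`decay_iteration`),
`∫∫_{Q_ρ} |u|³ ≲ (A³ + Λ^{3/2}) ρ⁵` (cubic interpolation on `(0,t₀) × B_{3/1024}(y)`), and with the
local pressure expansion at the centre `y` and the *parabolic* radius `ρ` (Kang–Miura–Tsai 2021,
Lemma 3.4; `IsLocalLeraySolutionOn.exists_pressure_decomposition`), whose gauge `c_{y,ρ}(t)` is
admissible for the criterion (`IsSuitableWeakSolutionOn.sub_timeGauge_slab`): the near field is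
controlled in `L^{3/2}` by the cubic integral on `B_{2ρ}(y)` (Calderón–Zygmund), the far field is
bounded pointwise by `Cρ ∫_{|w-y|≥2ρ} |u|²|w-y|⁻⁴ ≲ A² + Λ + α²` (annulus `2ρ ≤ |w-y| ≤ 3/1024`:
`|u|² ≤ 8A² + 2|v|²`, `|w-y|⁻⁴ ≤ (2ρ)⁻⁴`, `∫_{|z|≥2ρ}|z|⁻⁴ = c/ρ`; outside: the uniformly local
energy of `u`). Hence `∫∫_{Q_ρ}(|u|³ + |p - c|^{3/2}) ≤ K ρ⁵ = (K^{1/3}ρ)³ ρ²`, and for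
`ρ ≤ ε₀ K^{-1/3}` the criterion gives `|u| ≤ 2 C₀ K^{1/3}` a.e. on `Q_{ρ/2}(t₀, y)`; countably many
such half-cylinders cover `(0, T) × B_{1/2}(x₀)`.

* `ckn_bound_cylinder` — the criterion for a slab local Leray solution with a time gauge;
* `lintegral_compl_ball_powKer_four_translate`, `far_field_pointwise_le` — the far-field bound
  at small radius;
* `ae_bound_near_initial_time` — the boundedness statement.

## References

* H. Jia, V. Šverák, Invent. Math. 196 (2014) = arXiv:1204.0529, §3, proof of Thm. 3.1 (p. 8).
  Bib key `JiaSverak2014`.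
* P. G. Lemarié-Rieusset, *The Navier–Stokes Problem in the 21st Century* (2016), Thm. 14.4
  (p. 505) and the proof of Thm. 14.5 (p. 512). Bib key `LemarieRieusset2016`.
* K. Kang, H. Miura, T.-P. Tsai, IMRN 2021 = arXiv:1812.10509, Lemma 3.4 and §8. Bib key
  `KangMiuraTsai2020`.
-/

noncomputable section

open MeasureTheory TopologicalSpace Set Function Filter Metric
open _root_.Topology
open scoped ENNReal NNReal RealInnerProductSpace

namespace Literature.Analysis.FluidPDE

namespace JiaSverak2014

/-! ### The ε-regularity criterion for a gauged slab solution -/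

/-- **The ε-regularity criterion on a parabolic cylinder of a slab local Leray solution, with a
time gauge** (Lemarié-Rieusset 2016, Thm. 14.4, in the packaging of the tree's
`IsSuitableWeakSolutionOn.farField_bound_of_ckn_decay`): there are `ε₀, C₀ > 0` such that for a
local Leray solution `(u, p)` on `(0,T') × ℝ³`, a gauge `c ∈ L^{3/2}(0,T')`, a cylinder
`Q_ρ(t₀, y)` with `ρ² < t₀ < T'` and `0 ≤ l ≤ ε₀`:
`∫∫_{Q_ρ(t₀,y)} (|u|³ + |p - c|^{3/2}) ≤ l³ρ²` implies `|u| ≤ C₀ l/ρ` a.e. on `Q_{ρ/2}(t₀, y)`.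
[cite: LemarieRieusset2016, Thm. 14.4 (p. 505) and proof of Thm. 14.5 (p. 512)] -/
theorem ckn_bound_cylinder : ∃ ε₀ C₀ : ℝ, 0 < ε₀ ∧ 0 < C₀ ∧
    ∀ {T' : ℝ} {u₀ : (EuclideanSpace ℝ (Fin 3)) → (EuclideanSpace ℝ (Fin 3))}
      {u : ℝ → (EuclideanSpace ℝ (Fin 3)) → (EuclideanSpace ℝ (Fin 3))} {p : ℝ → (EuclideanSpace ℝ (Fin 3)) → ℝ},
      IsLocalLeraySolutionOn T' 1 u₀ u p → ∀ {c : ℝ → ℝ}, MemLp c (3 / 2 : ℝ≥0∞) (volume.restrict (Ioo 0 T')) →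
      ∀ (t₀ : ℝ) (y : EuclideanSpace ℝ (Fin 3)) (ρ l : ℝ), 0 < ρ → ρ ^ 2 < t₀ → t₀ < T' → 0 ≤ l → l ≤ ε₀ →
      ∫⁻ w in parabolicCylinder ρ ((t₀, y) : ℝ × EuclideanSpace ℝ (Fin 3)),
          (‖u w.1 w.2‖ₑ ^ (3 : ℕ) + ‖p w.1 w.2 - c w.1‖ₑ ^ (3 / 2 : ℝ)) ≤ ENNReal.ofReal (l ^ 3 * ρ ^ 2) →
      ∀ᵐ w ∂(volume.restrict (parabolicCylinder (ρ / 2) ((t₀, y) : ℝ × EuclideanSpace ℝ (Fin 3)))),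
        ‖u w.1 w.2‖ ≤ C₀ * l / ρ := by
  obtain ⟨ε₀, C₀, hε₀, hC₀, H⟩ :=
    (lemarieRieusset_epsilon_regularity_iff.1 lemarieRieusset_epsilon_regularity_holds) 1 3 one_pos (by norm_num)
  refine ⟨ε₀, C₀, hε₀, hC₀, ?_⟩
  intro T' u₀ u p hu c hc t₀ y ρ l hρ hρt ht₀T hl hlε hsmall
  have ht₀ : 0 < t₀ := lt_trans (by positivity) hρt
  -- the gauged suitable weak solution on the open slab `(0, T') × ℝ³`
  have hslab : IsSuitableWeakSolutionOn (slab (EuclideanSpace ℝ (Fin 3)) (Ioo 0 T') isOpen_Ioo)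
      1 0 u (fun s x => p s x - c s) := hu.suitable.sub_timeGauge_slab hc
  -- the box `Ω = (τ, t₀) × B(y, ρ + 1)`, `τ = (t₀ - ρ²)/2`, and its compact closure `K` in the slab
  set τ : ℝ := (t₀ - ρ ^ 2) / 2 with hτ
  have hτpos : 0 < τ := by rw [hτ]; linarith
  have hτlt : τ < t₀ - ρ ^ 2 := by rw [hτ]; linarith
  let Ω : Opens (ℝ × EuclideanSpace ℝ (Fin 3)) :=
    ⟨Ioo τ t₀ ×ˢ ball y (ρ + 1), isOpen_Ioo.prod isOpen_ball⟩
  have hΩle : Ω ≤ slab (EuclideanSpace ℝ (Fin 3)) (Ioo 0 T') isOpen_Ioo := fun z hz =>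
    mem_slab.2 ⟨hτpos.trans hz.1.1, hz.1.2.trans ht₀T⟩
  set K : Set (ℝ × EuclideanSpace ℝ (Fin 3)) := Icc τ t₀ ×ˢ closedBall y (ρ + 1) with hK
  have hKc : IsCompact K := isCompact_Icc.prod (isCompact_closedBall _ _)
  have hΩK : (Ω : Set (ℝ × EuclideanSpace ℝ (Fin 3))) ⊆ K :=
    prod_mono Ioo_subset_Icc_self ball_subset_closedBall
  have hKs : K ⊆ (slab (EuclideanSpace ℝ (Fin 3)) (Ioo 0 T') isOpen_Ioo :
      Set (ℝ × EuclideanSpace ℝ (Fin 3))) := fun z hz =>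
    ⟨⟨hτpos.trans_le hz.1.1, hz.1.2.trans_lt ht₀T⟩, mem_univ _⟩
  obtain ⟨G, hG, hG2, hloc⟩ := hslab.localEnergy
  have hLR : IsLRSuitableWeakSolutionOn Ω 1 3 0 u (fun s x => p s x - c s) G :=
    { isConnected :=
        (isConnected_Ioo (by nlinarith [sq_nonneg ρ] : τ < t₀)).prod (isConnected_ball (by linarith))
      energyClass := by
        obtain ⟨C, hC⟩ := hslab.energyClass K hKs hKc
        exact ⟨C, hC.mono fun s hs => (lintegral_mono fun x =>
          indicator_le_indicator_of_subset hΩK (fun _ => zero_le) _).trans hs⟩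
      weakGradient := hG.mono hΩle
      gradient_lt_top := (lintegral_mono_set hΩK).trans_lt (hG2 K hKs hKc)
      pressure_lt_top := (lintegral_mono_set hΩK).trans_lt (hslab.pressure K hKs hKc)
      force_memLp := by
        rw [uncurry_zero]
        exact MemLp.zero
      distributional := (hslab.of_le hΩle).distributional
      localEnergy := fun φ hφ hφ0 => hloc φ (hφ.mono hΩle) hφ0 }
  -- the cylinder `Q_ρ(t₀, y)` lies in `Ω`
  have hcylΩ : parabolicCylinder ρ ((t₀, y) : ℝ × EuclideanSpace ℝ (Fin 3)) ⊆ (Ω : Set (ℝ × EuclideanSpace ℝ (Fin 3))) := by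
    intro w hw
    rw [mem_parabolicCylinder] at hw
    exact ⟨⟨by linarith [hw.1.1], by linarith [hw.1.2]⟩, mem_ball.2 (by linarith [hw.2])⟩
  refine H Ω 0 u _ G hLR (t₀, y) ρ l hρ hcylΩ hl hlε hsmall ?_
  simp

/-! ### The far field at small radius -/

/-- Translation: `∫_{|w-y|≥R} |w-y|⁻⁴ dw = ∫_{|z|≥R} |z|⁻⁴ dz = R⁻¹ ∫_{|z|≥1}|z|⁻⁴`. [folklore] -/
theorem lintegral_compl_ball_powKer_four_translate (y : EuclideanSpace ℝ (Fin 3)) {R : ℝ} (hR : 0 < R) :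
    ∫⁻ w in (ball y R)ᶜ, RieszKernel.powKer 4 (w - y) =
      ENNReal.ofReal (R⁻¹ * (∫⁻ u in (ball (0 : EuclideanSpace ℝ (Fin 3)) 1)ᶜ, RieszKernel.powKer 4 u).toReal) := by
  have hmp : MeasurePreserving (fun w : EuclideanSpace ℝ (Fin 3) => w - y) volume volume :=
    measurePreserving_sub_right volume y
  have hemb : MeasurableEmbedding (fun w : EuclideanSpace ℝ (Fin 3) => w - y) :=
    (Homeomorph.subRight y).measurableEmbedding
  have h := hmp.setLIntegral_comp_preimage_emb hemb (RieszKernel.powKer 4) (ball (0 : EuclideanSpace ℝ (Fin 3)) R)ᶜ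
  have hpre : (fun w : EuclideanSpace ℝ (Fin 3) => w - y) ⁻¹' (ball (0 : EuclideanSpace ℝ (Fin 3)) R)ᶜ = (ball y R)ᶜ := by
    ext w
    simp [mem_ball, dist_eq_norm]
  rw [hpre] at h
  rw [h, Literature.Analysis.Potential.setLIntegral_compl_ball_powKer_four hR]

/-- On `{|w - y| ≥ 2ρ}` the quartic kernel is at most `(2ρ)⁻⁴`. [folklore] -/
theorem powKer_four_le_of_mem_compl {y w : EuclideanSpace ℝ (Fin 3)} {ρ : ℝ} (hρ : 0 < ρ)
    (hw : w ∈ (ball y (2 * ρ))ᶜ) : RieszKernel.powKer 4 (w - y) ≤ ENNReal.ofReal ((2 * ρ) ^ (-(4 : ℝ))) := by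
  rw [mem_compl_iff, mem_ball, dist_eq_norm, not_lt] at hw
  unfold RieszKernel.powKer
  exact ENNReal.ofReal_le_ofReal (Real.rpow_le_rpow_of_nonpos (by positivity) hw (by norm_num))

/-- **The tail at small radius**: for a measurable slice `U` with `|U|² ≤ C_c + 2|V|²` on
`B_R(y)`, `∫_{B_R(y)}|V|² ≤ E_V`, `∫_{|w-y|≥R}|U|²|w-y|⁻⁴ ≤ T_L` and `2ρ ≤ R`,
`∫_{|w-y|≥2ρ} |U|²|w-y|⁻⁴ ≤ C_c (2ρ)⁻¹ I₄ + 2(2ρ)⁻⁴ E_V + T_L` (`I₄ = ∫_{|z|≥1}|z|⁻⁴`). [folklore] -/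
theorem far_tail_le {U V : (EuclideanSpace ℝ (Fin 3)) → (EuclideanSpace ℝ (Fin 3))} {y : EuclideanSpace ℝ (Fin 3)}
    {ρ R : ℝ} {Cc EV TL : ℝ≥0∞} (hρ : 0 < ρ) (hρR : 2 * ρ ≤ R)
    (hsq : ∀ w ∈ ball y R, ‖U w‖ₑ ^ (2 : ℕ) ≤ Cc + 2 * ‖V w‖ₑ ^ 2)
    (hV : ∫⁻ w in ball y R, ‖V w‖ₑ ^ 2 ≤ EV)
    (hTL : ∫⁻ w in (ball y R)ᶜ, ‖U w‖ₑ ^ (2 : ℕ) * RieszKernel.powKer 4 (w - y) ≤ TL) :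
    ∫⁻ w in (ball y (2 * ρ))ᶜ, ‖U w‖ₑ ^ (2 : ℕ) * RieszKernel.powKer 4 (w - y) ≤
      Cc * ENNReal.ofReal ((2 * ρ)⁻¹ * (∫⁻ u in (ball (0 : EuclideanSpace ℝ (Fin 3)) 1)ᶜ, RieszKernel.powKer 4 u).toReal) +
        2 * ENNReal.ofReal ((2 * ρ) ^ (-(4 : ℝ))) * EV + TL := by
  have h2ρ : 0 < 2 * ρ := by positivity
  -- split the exterior of `B_{2ρ}` into the annulus and the exterior of `B_R`
  have hsplit : (ball y (2 * ρ))ᶜ = ((ball y (2 * ρ))ᶜ ∩ ball y R) ∪ (ball y R)ᶜ := by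
    ext w
    simp only [mem_compl_iff, mem_union, mem_inter_iff, mem_ball]
    constructor
    · intro h; by_cases hw : dist w y < R
      · exact Or.inl ⟨h, hw⟩
      · exact Or.inr hw
    · rintro (⟨h, -⟩ | h)
      · exact h
      · exact fun h' => h (h'.trans_le hρR)
  have hK : Measurable fun w : EuclideanSpace ℝ (Fin 3) => RieszKernel.powKer 4 (w - y) := by
    unfold RieszKernel.powKer
    exact (((continuous_norm.comp (continuous_id.sub continuous_const)).measurable.pow_const _)).ennreal_ofReal
  calc ∫⁻ w in (ball y (2 * ρ))ᶜ, ‖U w‖ₑ ^ (2 : ℕ) * RieszKernel.powKer 4 (w - y)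
      ≤ (∫⁻ w in (ball y (2 * ρ))ᶜ ∩ ball y R, ‖U w‖ₑ ^ (2 : ℕ) * RieszKernel.powKer 4 (w - y)) +
          ∫⁻ w in (ball y R)ᶜ, ‖U w‖ₑ ^ (2 : ℕ) * RieszKernel.powKer 4 (w - y) := by
        conv_lhs => rw [hsplit]
        exact lintegral_union_le _ _ _
    _ ≤ (∫⁻ w in (ball y (2 * ρ))ᶜ ∩ ball y R, (Cc * RieszKernel.powKer 4 (w - y) +
          2 * ENNReal.ofReal ((2 * ρ) ^ (-(4 : ℝ))) * ‖V w‖ₑ ^ 2)) + TL := by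
        refine add_le_add (setLIntegral_mono' (measurableSet_ball.compl.inter measurableSet_ball) fun w hw => ?_) hTL
        calc ‖U w‖ₑ ^ (2 : ℕ) * RieszKernel.powKer 4 (w - y)
            ≤ (Cc + 2 * ‖V w‖ₑ ^ 2) * RieszKernel.powKer 4 (w - y) := mul_le_mul' (hsq w hw.2) le_rfl
          _ = Cc * RieszKernel.powKer 4 (w - y) + 2 * RieszKernel.powKer 4 (w - y) * ‖V w‖ₑ ^ 2 := by ring
          _ ≤ Cc * RieszKernel.powKer 4 (w - y) + 2 * ENNReal.ofReal ((2 * ρ) ^ (-(4 : ℝ))) * ‖V w‖ₑ ^ 2 := by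
              gcongr
              exact powKer_four_le_of_mem_compl hρ hw.1
    _ = Cc * (∫⁻ w in (ball y (2 * ρ))ᶜ ∩ ball y R, RieszKernel.powKer 4 (w - y)) +
          2 * ENNReal.ofReal ((2 * ρ) ^ (-(4 : ℝ))) * (∫⁻ w in (ball y (2 * ρ))ᶜ ∩ ball y R, ‖V w‖ₑ ^ 2) + TL := by
        rw [lintegral_add_left' ((hK.const_mul _).aemeasurable), lintegral_const_mul _ hK,
          lintegral_const_mul' _ _ (ENNReal.mul_ne_top ENNReal.ofNat_ne_top ENNReal.ofReal_ne_top)]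
    _ ≤ Cc * (∫⁻ w in (ball y (2 * ρ))ᶜ, RieszKernel.powKer 4 (w - y)) +
          2 * ENNReal.ofReal ((2 * ρ) ^ (-(4 : ℝ))) * (∫⁻ w in ball y R, ‖V w‖ₑ ^ 2) + TL := by
        gcongr
        · exact inter_subset_left
        · exact inter_subset_right
    _ ≤ _ := by
        rw [lintegral_compl_ball_powKer_four_translate y h2ρ]
        gcongr

/-- `(a + b)³ ≤ 4a³ + 4b³` in `ℝ≥0∞`. [folklore] -/
private theorem ennreal_add_pow_three_le (a b : ℝ≥0∞) : (a + b) ^ (3 : ℕ) ≤ 4 * a ^ (3 : ℕ) + 4 * b ^ (3 : ℕ) := by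
  have h := ENNReal.rpow_add_le_mul_rpow_add_rpow a b (by norm_num : (1 : ℝ) ≤ 3)
  have e : ∀ x : ℝ≥0∞, x ^ (3 : ℝ) = x ^ (3 : ℕ) := fun x => by
    rw [show (3 : ℝ) = ((3 : ℕ) : ℝ) by norm_num, ENNReal.rpow_natCast]
  have e2 : (2 : ℝ≥0∞) ^ ((3 : ℝ) - 1) = 4 := by
    rw [show (3 : ℝ) - 1 = ((2 : ℕ) : ℝ) by norm_num, ENNReal.rpow_natCast]; norm_num
  rw [e, e, e, e2] at h
  calc (a + b) ^ (3 : ℕ) ≤ 4 * (a ^ (3 : ℕ) + b ^ (3 : ℕ)) := h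
    _ = 4 * a ^ (3 : ℕ) + 4 * b ^ (3 : ℕ) := by ring

/-- **The cubic integral of `u = a + v` on a cylinder** `(0,t₀) × B_R(y)`:
`∫∫ |u|³ ≤ 4·(8A³)·t₀|B_R| + 4 ∫∫_{(0,t₀)×B_R(y)} |v|³` when `|a| ≤ 2A`. [folklore] -/
theorem lintegral_cube_le_of_flow_bound {S₂ A t₀ R : ℝ} {u a : ℝ → (EuclideanSpace ℝ (Fin 3)) → (EuclideanSpace ℝ (Fin 3))}
    {y : EuclideanSpace ℝ (Fin 3)} (hbd : ∀ t ∈ Ioo 0 S₂, ∀ x, ‖a t x‖ ≤ 2 * A) (ht₀ : t₀ ≤ S₂) (hA : 0 ≤ A)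
    (hvm : AEStronglyMeasurable (fun z : ℝ × EuclideanSpace ℝ (Fin 3) => u z.1 z.2 - a z.1 z.2) (volume.restrict (Ioo 0 t₀ ×ˢ ball y R))) :
    ∫⁻ z in Ioo 0 t₀ ×ˢ ball y R, ‖u z.1 z.2‖ₑ ^ (3 : ℕ) ≤
      4 * ENNReal.ofReal (8 * A ^ 3) * volume (Ioo 0 t₀ ×ˢ ball y R) +
        4 * ∫⁻ z in Ioo 0 t₀ ×ˢ ball y R, ‖u z.1 z.2 - a z.1 z.2‖ₑ ^ (3 : ℕ) := by
  have hmem : ∀ᵐ z ∂(volume.restrict (Ioo 0 t₀ ×ˢ ball y R)), z ∈ Ioo 0 t₀ ×ˢ ball y R :=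
    ae_restrict_mem (measurableSet_Ioo.prod measurableSet_ball)
  have h2A : ENNReal.ofReal (2 * A) ^ (3 : ℕ) = ENNReal.ofReal (8 * A ^ 3) := by
    rw [← ENNReal.ofReal_pow (by positivity)]; congr 1; ring
  calc ∫⁻ z in Ioo 0 t₀ ×ˢ ball y R, ‖u z.1 z.2‖ₑ ^ (3 : ℕ)
      ≤ ∫⁻ z in Ioo 0 t₀ ×ˢ ball y R, (4 * ENNReal.ofReal (8 * A ^ 3) + 4 * ‖u z.1 z.2 - a z.1 z.2‖ₑ ^ (3 : ℕ)) := by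
        refine lintegral_mono_ae (hmem.mono fun z hz => ?_)
        have hzS : z.1 ∈ Ioo (0 : ℝ) S₂ := ⟨hz.1.1, hz.1.2.trans_le ht₀⟩
        have hu_le : ‖u z.1 z.2‖ₑ ≤ ENNReal.ofReal (2 * A) + ‖u z.1 z.2 - a z.1 z.2‖ₑ := by
          have e : u z.1 z.2 = a z.1 z.2 + (u z.1 z.2 - a z.1 z.2) := by abel
          calc ‖u z.1 z.2‖ₑ = ‖a z.1 z.2 + (u z.1 z.2 - a z.1 z.2)‖ₑ := by rw [← e]
            _ ≤ ‖a z.1 z.2‖ₑ + ‖u z.1 z.2 - a z.1 z.2‖ₑ := enorm_add_le _ _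
            _ ≤ ENNReal.ofReal (2 * A) + ‖u z.1 z.2 - a z.1 z.2‖ₑ := by
                gcongr; rw [← ofReal_norm]; exact ENNReal.ofReal_le_ofReal (hbd z.1 hzS z.2)
        calc ‖u z.1 z.2‖ₑ ^ (3 : ℕ) ≤ (ENNReal.ofReal (2 * A) + ‖u z.1 z.2 - a z.1 z.2‖ₑ) ^ (3 : ℕ) := by gcongr
          _ ≤ 4 * ENNReal.ofReal (2 * A) ^ (3 : ℕ) + 4 * ‖u z.1 z.2 - a z.1 z.2‖ₑ ^ (3 : ℕ) := ennreal_add_pow_three_le _ _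
          _ = 4 * ENNReal.ofReal (8 * A ^ 3) + 4 * ‖u z.1 z.2 - a z.1 z.2‖ₑ ^ (3 : ℕ) := by rw [h2A]
    _ = 4 * ENNReal.ofReal (8 * A ^ 3) * volume (Ioo 0 t₀ ×ˢ ball y R) +
          4 * ∫⁻ z in Ioo 0 t₀ ×ˢ ball y R, ‖u z.1 z.2 - a z.1 z.2‖ₑ ^ (3 : ℕ) := by
        rw [lintegral_add_left' aemeasurable_const, lintegral_const, Measure.restrict_apply_univ,
          lintegral_const_mul'' _ (hvm.aemeasurable.enorm.pow_const _)]

/-! ### The boundedness statement -/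

set_option maxHeartbeats 6400000 in
/-- **Boundedness of `u` near the initial time from the decay of the perturbation**
(Jia–Šverák 2014, proof of Thm. 3.1, arXiv p. 8: "`‖u‖_{L^∞(B_{1/2}(x₀)×(0,T₂))} ≤ C₁(α,γ,M)`",
here through the standard ε-regularity criterion at the parabolic scale, module docstring).
For parameters `A > 0`, `Λ`, `α_u` there are `T₂ > 0` and `K_b` such that: for a local Leray
solution `(u,p)` on `(0,T') × ℝ³` with a weak gradient `G`, a classical flow `a` on `(0,S₂)` with
`|a| ≤ 2A`, a time `0 < T₀ ≤ min(T', S₂)`, the uniformly local bound `∫_{B(z,1)}|u(t)|² ≤ α_u`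
for a.e. `t`, and the decay `∫_{B_{3/1024}(y)}|u(s) - a(s)|² ≤ Λ t^{3/2}` (a.e. `s < t`),
`∫∫_{(0,t)×B_{3/1024}(y)}|G - Da|² ≤ Λ t^{3/2}` for all `y ∈ B_{R₀}(x₀)`, `t ∈ (0,T₀]`, one has
`|u| ≤ K_b` a.e. on `(0, min(T₂,T₀)) × B_{R₀}(x₀)` (in print `R₀ = 1/2`).
[cite: JiaSverak2014, §3 proof of Thm. 3.1 (arXiv p. 8)] [cite: LemarieRieusset2016, Thm. 14.4 (p. 505)] [cite: KangMiuraTsai2020, Lemma 3.4] -/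
theorem ae_bound_near_initial_time (A : ℝ) (Λ αu : ℝ≥0) (hA : 0 < A) (R₀ : ℝ) :
    ∃ T₂ : ℝ, 0 < T₂ ∧ ∃ Kb : ℝ, ∀ {T' S₂ T₀ : ℝ}
      {u₀ : (EuclideanSpace ℝ (Fin 3)) → (EuclideanSpace ℝ (Fin 3))} {u a : ℝ → (EuclideanSpace ℝ (Fin 3)) → (EuclideanSpace ℝ (Fin 3))}
      {p π : ℝ → (EuclideanSpace ℝ (Fin 3)) → ℝ}
      {G : ℝ → (EuclideanSpace ℝ (Fin 3)) → (EuclideanSpace ℝ (Fin 3)) →L[ℝ] (EuclideanSpace ℝ (Fin 3))} {x₀ : EuclideanSpace ℝ (Fin 3)},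
      IsLocalLeraySolutionOn T' 1 u₀ u p →
      HasWeakSpatialGradientOn (slab (EuclideanSpace ℝ (Fin 3)) (Ioo 0 T') isOpen_Ioo) u G →
      IsClassicalNSSolutionOn (Ioo 0 S₂) 1 0 a π →
      (∀ t ∈ Ioo 0 S₂, ∀ x, ‖a t x‖ ≤ 2 * A) →
      0 < T₀ → T₀ ≤ T' → T₀ ≤ S₂ →
      (∀ᵐ t ∂(volume.restrict (Ioo 0 T')), ∀ z : EuclideanSpace ℝ (Fin 3), ∫⁻ x in ball z 1, ‖u t x‖ₑ ^ 2 ≤ αu) →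
      (∀ y ∈ ball x₀ R₀, ∀ t ∈ Ioc 0 T₀,
        (∀ᵐ s ∂(volume.restrict (Ioo 0 t)),
            ∫⁻ x in ball y (3 / 1024), ‖u s x - a s x‖ₑ ^ 2 ≤ Λ * ENNReal.ofReal (t ^ (3 / 2 : ℝ))) ∧
          ∫⁻ z in Ioo 0 t ×ˢ ball y (3 / 1024),
              ENNReal.ofReal (frobeniusNormSq (G z.1 z.2 - fderiv ℝ (a z.1) z.2)) ≤
            Λ * ENNReal.ofReal (t ^ (3 / 2 : ℝ))) →
      ∀ᵐ z ∂(volume.restrict (Ioo 0 (min T₂ T₀) ×ˢ ball x₀ R₀)), ‖u z.1 z.2‖ ≤ Kb := by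
  -- ## the universal constants
  obtain ⟨ε₀, C₀, hε₀, hC₀, Hckn⟩ := ckn_bound_cylinder
  obtain ⟨Kc, hKc⟩ := exists_lintegral_cube_cylinder_le_ball (3 / 1024 : ℝ)
  obtain ⟨Cn, -, hCnt, hCn⟩ := exists_lintegral_localPressureNear_le stein1970_normalisedPressure_ae_Lp_bound_holds
  obtain ⟨CK, hCK0, hCK⟩ := exists_abs_pressureKernel_sub_le
  obtain ⟨Kt, hKtt, hKtail⟩ := exists_farField_tail_le (r := (3 / 2048 : ℝ)) (by norm_num)
  set I4 : ℝ := (∫⁻ u in (ball (0 : EuclideanSpace ℝ (Fin 3)) 1)ᶜ, RieszKernel.powKer 4 u).toReal with hI4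
  have hI40 : 0 ≤ I4 := ENNReal.toReal_nonneg
  set V₁ : ℝ≥0∞ := volume (ball (0 : EuclideanSpace ℝ (Fin 3)) 1) with hV₁
  have hV₁t : V₁ ≠ ⊤ := measure_ball_lt_top.ne
  have hV₁0 : V₁ ≠ 0 := (measure_ball_pos volume (0 : EuclideanSpace ℝ (Fin 3)) one_pos).ne'
  set τK : ℝ≥0∞ := Kt * ENNReal.ofReal (((3 / 1024 : ℝ) - 3 / 2048)⁻¹) * αu with hτK
  have hτKt : τK ≠ ⊤ := by simp only [hτK]; finiteness
  set Finf : ℝ≥0∞ := ENNReal.ofReal (4 * CK * A ^ 2 * I4) + (Λ : ℝ≥0∞) * ENNReal.ofReal CK + ENNReal.ofReal CK * τK with hFinf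
  have hFinft : Finf ≠ ⊤ := by simp only [hFinf]; finiteness
  set B₀ : ℝ≥0∞ := 4 * ENNReal.ofReal (8 * A ^ 3) * V₁ + 8 * Kc * (Λ : ℝ≥0∞) ^ (3 / 2 : ℝ) with hB₀
  have hΛ32 : (Λ : ℝ≥0∞) ^ (3 / 2 : ℝ) ≠ ⊤ := ENNReal.rpow_ne_top_of_nonneg (by norm_num) ENNReal.coe_ne_top
  have hB₀t : B₀ ≠ ⊤ := by simp only [hB₀]; finiteness
  have hF32 : Finf ^ (3 / 2 : ℝ) ≠ ⊤ := ENNReal.rpow_ne_top_of_nonneg (by norm_num) hFinft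
  set s2 : ℝ≥0∞ := (2 : ℝ≥0∞) ^ (1 / 2 : ℝ) with hs2
  have hs2t : s2 ≠ ⊤ := ENNReal.rpow_ne_top_of_nonneg (by norm_num) ENNReal.ofNat_ne_top
  set Ktot : ℝ≥0∞ := B₀ + s2 * (Cn * B₀ + Finf ^ (3 / 2 : ℝ) * V₁) with hKtot
  have hKtott : Ktot ≠ ⊤ := by simp only [hKtot]; finiteness
  have hB₀pos : 0 < B₀ := by
    have h1 : 0 < 4 * ENNReal.ofReal (8 * A ^ 3) * V₁ :=
      ENNReal.mul_pos (mul_ne_zero (by norm_num) (ENNReal.ofReal_pos.2 (by positivity)).ne') hV₁0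
    exact h1.trans_le le_self_add
  have hKtotpos : 0 < Ktot.toReal := ENNReal.toReal_pos (hB₀pos.trans_le le_self_add).ne' hKtott
  set L : ℝ := (4 * Ktot.toReal) ^ (1 / 3 : ℝ) with hL
  have hLpos : 0 < L := Real.rpow_pos_of_pos (by positivity) _
  have hL3 : L ^ 3 = 4 * Ktot.toReal := by
    rw [hL, ← Real.rpow_natCast, ← Real.rpow_mul (by positivity)]; norm_num
  set T₂ : ℝ := min ((3 / 1024 : ℝ) ^ 2) (min 1 ((ε₀ / L) ^ 2)) with hT₂
  have hT₂pos : 0 < T₂ := lt_min (by norm_num) (lt_min one_pos (by positivity))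
  refine ⟨T₂, hT₂pos, 2 * C₀ * L, ?_⟩
  intro T' S₂ T₀ u₀ u a p π G x₀ hu hG hcl hbd hT₀ hT₀T' hT₀S₂ hαu hdec
  -- ## the bound on one half-cylinder `Q_{√t₀/4}(t₀, y)`
  have hcyl : ∀ (t₀ : ℝ) (y : EuclideanSpace ℝ (Fin 3)), 0 < t₀ → t₀ < min T₂ T₀ → y ∈ ball x₀ R₀ →
      ∀ᵐ w ∂(volume.restrict (parabolicCylinder (Real.sqrt t₀ / 2 / 2) ((t₀, y) : ℝ × EuclideanSpace ℝ (Fin 3)))),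
        ‖u w.1 w.2‖ ≤ 2 * C₀ * L := by
    intro t₀ y ht₀ ht₀lt hy
    have ht₀T₂ : t₀ < T₂ := ht₀lt.trans_le (min_le_left _ _)
    have ht₀T₀ : t₀ < T₀ := ht₀lt.trans_le (min_le_right _ _)
    have ht₀T' : t₀ < T' := ht₀T₀.trans_le hT₀T'
    have ht₀S₂ : t₀ < S₂ := ht₀T₀.trans_le hT₀S₂
    have ht₀1 : t₀ ≤ 1 := (ht₀T₂.trans_le ((min_le_right _ _).trans (min_le_left _ _))).le
    -- the parabolic radius
    set s : ℝ := Real.sqrt t₀ with hsdef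
    have hs : 0 < s := Real.sqrt_pos.2 ht₀
    have hs2 : s ^ 2 = t₀ := Real.sq_sqrt ht₀.le
    have hs1 : s ≤ 1 := by rw [hsdef, Real.sqrt_le_one]; exact ht₀1
    have hsr : s ≤ 3 / 1024 := by
      rw [hsdef, ← Real.sqrt_sq (by norm_num : (0 : ℝ) ≤ 3 / 1024)]
      exact Real.sqrt_le_sqrt (ht₀T₂.trans_le (min_le_left _ _)).le
    have hsε : L * s ≤ ε₀ := by
      have h1 : t₀ ≤ (ε₀ / L) ^ 2 := (ht₀T₂.trans_le ((min_le_right _ _).trans (min_le_right _ _))).le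
      have h2 : s ≤ ε₀ / L := by
        rw [hsdef, ← Real.sqrt_sq (by positivity : (0 : ℝ) ≤ ε₀ / L)]
        exact Real.sqrt_le_sqrt h1
      rwa [le_div_iff₀ hLpos, mul_comm] at h2
    set ρ : ℝ := s / 2 with hρdef
    have hρ : 0 < ρ := by positivity
    have hρ1 : ρ ≤ 1 := by rw [hρdef]; linarith
    have hρr : ρ ≤ 3 / 1024 := by rw [hρdef]; linarith
    have h2ρ : 2 * ρ = s := by rw [hρdef]; ring
    have hρt : ρ ^ 2 < t₀ := by rw [hρdef, ← hs2]; nlinarith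
    -- the gauge of the local pressure expansion at `(y, ρ)`
    obtain ⟨c, hcL, hdecomp⟩ := hu.exists_pressure_decomposition y hρ
    -- the decay at the time `t₀`
    obtain ⟨hEv, hDv⟩ := hdec y hy t₀ ⟨ht₀, ht₀T₀.le⟩
    -- ### measurability and the weak gradient of `v`
    have hIT' : Ioo 0 t₀ ⊆ Ioo 0 T' := Ioo_subset_Ioo_right ht₀T'.le
    have hIS₂ : Ioo 0 t₀ ⊆ Ioo 0 S₂ := Ioo_subset_Ioo_right ht₀S₂.le
    have hstripm : MeasurableSet (Ioo 0 t₀ ×ˢ (univ : Set (EuclideanSpace ℝ (Fin 3)))) := measurableSet_Ioo.prod MeasurableSet.univ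
    have hum : AEStronglyMeasurable (uncurry u) (volume.restrict (Ioo 0 t₀ ×ˢ (univ : Set (EuclideanSpace ℝ (Fin 3))))) :=
      hu.aestronglyMeasurable.mono_measure (Measure.restrict_mono (Set.prod_mono hIT' Subset.rfl) le_rfl)
    have ham : AEStronglyMeasurable (uncurry a) (volume.restrict (Ioo 0 t₀ ×ˢ (univ : Set (EuclideanSpace ℝ (Fin 3))))) :=
      (hcl.smooth_velocity.continuousOn.mono (Set.prod_mono hIS₂ Subset.rfl)).aestronglyMeasurable hstripm
    have hvm : ∀ R : ℝ, AEStronglyMeasurable (fun z : ℝ × EuclideanSpace ℝ (Fin 3) => u z.1 z.2 - a z.1 z.2)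
        (volume.restrict (Ioo 0 t₀ ×ˢ ball y R)) := fun R =>
      (hum.sub ham).mono_measure (Measure.restrict_mono (Set.prod_mono Subset.rfl (subset_univ _)) le_rfl)
    have humR : ∀ R : ℝ, AEStronglyMeasurable (uncurry u) (volume.restrict (Ioo 0 t₀ ×ˢ ball y R)) := fun R =>
      hum.mono_measure (Measure.restrict_mono (Set.prod_mono Subset.rfl (subset_univ _)) le_rfl)
    set Ω : Opens (EuclideanSpace ℝ (Fin 3)) := ⟨ball y (3 / 1024), isOpen_ball⟩ with hΩ
    have hQT : (timeCylinder Ω 0 t₀ : Opens (ℝ × EuclideanSpace ℝ (Fin 3))) ≤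
        slab (EuclideanSpace ℝ (Fin 3)) (Ioo 0 T') isOpen_Ioo := fun z hz => mem_slab.2 (hIT' hz.1)
    have hQS : ((timeCylinder Ω 0 t₀ : Opens (ℝ × EuclideanSpace ℝ (Fin 3))) : Set (ℝ × EuclideanSpace ℝ (Fin 3))) ⊆
        Ioo 0 S₂ ×ˢ (univ : Set (EuclideanSpace ℝ (Fin 3))) := fun z hz => ⟨hIS₂ hz.1, mem_univ _⟩
    have hvgrad : HasWeakSpatialGradientOn (timeCylinder Ω 0 t₀) (fun s x => u s x - a s x)
        (fun s x => G s x - fderiv ℝ (a s) x) := hasWeakSpatialGradientOn_sub_flow hG hcl hQT hQS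
    -- ### the cubic integral of `v` on `(0,t₀) × B_{3/1024}(y)`
    have ht32 : 0 ≤ t₀ ^ (3 / 2 : ℝ) := Real.rpow_nonneg ht₀.le _
    set Cdec : ℝ≥0 := Λ * (t₀ ^ (3 / 2 : ℝ)).toNNReal with hCdec
    have hCdecE : (Cdec : ℝ≥0∞) = (Λ : ℝ≥0∞) * ENNReal.ofReal (t₀ ^ (3 / 2 : ℝ)) := by
      rw [hCdec, ENNReal.coe_mul]
      rfl
    have hEv' : ∀ᵐ s' ∂(volume.restrict (Ioo 0 t₀)), ∫⁻ x in ball y (3 / 1024), ‖u s' x - a s' x‖ₑ ^ 2 ≤ Cdec := by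
      rw [hCdecE]; exact hEv
    have hDv' : ∫⁻ z in Ioo 0 t₀ ×ˢ ball y (3 / 1024), ENNReal.ofReal (frobeniusNormSq (G z.1 z.2 - fderiv ℝ (a z.1) z.2)) ≤ Cdec := by
      rw [hCdecE]; exact hDv
    have hKv : ∫⁻ z in Ioo 0 t₀ ×ˢ ball y (3 / 1024), ‖u z.1 z.2 - a z.1 z.2‖ₑ ^ (3 : ℕ) ≤
        2 * Kc * (Λ : ℝ≥0∞) ^ (3 / 2 : ℝ) * ENNReal.ofReal (s ^ 5) := by
      have h := hKc (fun s' x => u s' x - a s' x) (fun s' x => G s' x - fderiv ℝ (a s') x) t₀ Cdec t₀ y hvgrad hEv' hDv' ht₀ le_rfl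
      refine h.trans ?_
      rw [hCdecE, ENNReal.mul_rpow_of_nonneg _ _ (by norm_num), ENNReal.ofReal_rpow_of_nonneg ht32 (by norm_num)]
      -- real bookkeeping: `(t₀^{3/2})^{3/2} (t₀ + t₀^{1/4}) ≤ 2 s⁵`
      have e1 : (t₀ ^ (3 / 2 : ℝ)) ^ (3 / 2 : ℝ) = s ^ 4 * Real.sqrt s := by
        rw [← hs2, ← Real.rpow_natCast, ← Real.rpow_mul hs.le, ← Real.rpow_mul hs.le, Real.sqrt_eq_rpow,
          ← Real.rpow_natCast, ← Real.rpow_add hs]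
        norm_num
      have e2 : t₀ ^ (1 / 4 : ℝ) = Real.sqrt s := by
        rw [← hs2, ← Real.rpow_natCast, ← Real.rpow_mul hs.le, Real.sqrt_eq_rpow]; norm_num
      have hss : Real.sqrt s * Real.sqrt s = s := Real.mul_self_sqrt hs.le
      have hsq1 : Real.sqrt s ≤ 1 := by rw [Real.sqrt_le_one]; exact hs1
      have hreal : (t₀ ^ (3 / 2 : ℝ)) ^ (3 / 2 : ℝ) * (t₀ + t₀ ^ (1 / 4 : ℝ)) ≤ 2 * s ^ 5 := by
        rw [e1, e2, ← hs2]
        have hs0 := hs.le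
        have hsq0 := Real.sqrt_nonneg s
        have h1 : s ^ 2 ≤ Real.sqrt s := by
          calc s ^ 2 ≤ s := by nlinarith
            _ = Real.sqrt s * Real.sqrt s := hss.symm
            _ ≤ Real.sqrt s * 1 := by gcongr
            _ = Real.sqrt s := mul_one _
        calc s ^ 4 * Real.sqrt s * (s ^ 2 + Real.sqrt s) ≤ s ^ 4 * Real.sqrt s * (Real.sqrt s + Real.sqrt s) := by gcongr
          _ = 2 * (s ^ 4 * (Real.sqrt s * Real.sqrt s)) := by ring
          _ = 2 * s ^ 5 := by rw [hss]; ring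
      calc (Kc : ℝ≥0∞) * ((Λ : ℝ≥0∞) ^ (3 / 2 : ℝ) * ENNReal.ofReal ((t₀ ^ (3 / 2 : ℝ)) ^ (3 / 2 : ℝ))) *
            (ENNReal.ofReal t₀ + ENNReal.ofReal (t₀ ^ (1 / 4 : ℝ)))
          = Kc * (Λ : ℝ≥0∞) ^ (3 / 2 : ℝ) * ENNReal.ofReal ((t₀ ^ (3 / 2 : ℝ)) ^ (3 / 2 : ℝ) * (t₀ + t₀ ^ (1 / 4 : ℝ))) := by
            rw [← ENNReal.ofReal_add ht₀.le (Real.rpow_nonneg ht₀.le _), ENNReal.ofReal_mul (Real.rpow_nonneg ht32 _)]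
            ring
        _ ≤ Kc * (Λ : ℝ≥0∞) ^ (3 / 2 : ℝ) * ENNReal.ofReal (2 * s ^ 5) := by gcongr
        _ = 2 * Kc * (Λ : ℝ≥0∞) ^ (3 / 2 : ℝ) * ENNReal.ofReal (s ^ 5) := by
            rw [ENNReal.ofReal_mul zero_le_two, ENNReal.ofReal_ofNat]; ring
    -- ### the cubic integral of `u` on `(0,t₀) × B_R(y)`, `R = ρ, 2ρ`
    have hcubeU : ∀ {R : ℝ}, 0 ≤ R → R ≤ 3 / 1024 →
        ∫⁻ z in Ioo 0 t₀ ×ˢ ball y R, ‖u z.1 z.2‖ₑ ^ (3 : ℕ) ≤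
          4 * ENNReal.ofReal (8 * A ^ 3) * V₁ * ENNReal.ofReal (t₀ * R ^ 3) + 8 * Kc * (Λ : ℝ≥0∞) ^ (3 / 2 : ℝ) * ENNReal.ofReal (s ^ 5) := by
      intro R hR0 hRr
      have h := lintegral_cube_le_of_flow_bound (y := y) (R := R) hbd ht₀S₂.le hA.le (hvm R)
      refine h.trans ?_
      have hvol : volume (Ioo 0 t₀ ×ˢ ball y R) = ENNReal.ofReal (t₀ * R ^ 3) * V₁ := by
        rw [Measure.volume_eq_prod, Measure.prod_prod, Real.volume_Ioo, sub_zero,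
          Measure.addHaar_ball volume y hR0, finrank_euclideanSpace_fin, ENNReal.ofReal_mul ht₀.le, hV₁]
        ring
      rw [hvol]
      have hmono : ∫⁻ z in Ioo 0 t₀ ×ˢ ball y R, ‖u z.1 z.2 - a z.1 z.2‖ₑ ^ (3 : ℕ) ≤
          ∫⁻ z in Ioo 0 t₀ ×ˢ ball y (3 / 1024), ‖u z.1 z.2 - a z.1 z.2‖ₑ ^ (3 : ℕ) :=
        lintegral_mono_set (Set.prod_mono Subset.rfl (ball_subset_ball hRr))
      calc 4 * ENNReal.ofReal (8 * A ^ 3) * (ENNReal.ofReal (t₀ * R ^ 3) * V₁) +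
            4 * ∫⁻ z in Ioo 0 t₀ ×ˢ ball y R, ‖u z.1 z.2 - a z.1 z.2‖ₑ ^ (3 : ℕ)
          ≤ 4 * ENNReal.ofReal (8 * A ^ 3) * (ENNReal.ofReal (t₀ * R ^ 3) * V₁) +
            4 * (2 * Kc * (Λ : ℝ≥0∞) ^ (3 / 2 : ℝ) * ENNReal.ofReal (s ^ 5)) := by gcongr; exact hmono.trans hKv
        _ = _ := by ring
    -- ### the cylinder `Q = Q_ρ(t₀, y)`
    set Q : Set (ℝ × EuclideanSpace ℝ (Fin 3)) := parabolicCylinder ρ ((t₀, y) : ℝ × EuclideanSpace ℝ (Fin 3)) with hQdef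
    have hQeq : Q = Ioo (t₀ - ρ ^ 2) t₀ ×ˢ ball y ρ := rfl
    have hIQ : Ioo (t₀ - ρ ^ 2) t₀ ⊆ Ioo 0 t₀ := Ioo_subset_Ioo_left (by linarith)
    have hQsub : Q ⊆ Ioo 0 t₀ ×ˢ ball y ρ := by rw [hQeq]; exact Set.prod_mono hIQ Subset.rfl
    have hQT' : Q ⊆ Ioo 0 T' ×ˢ ball y ρ := hQsub.trans (Set.prod_mono hIT' Subset.rfl)
    have hprodQ : (volume.restrict Q : Measure (ℝ × EuclideanSpace ℝ (Fin 3))) =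
        (volume.restrict (Ioo (t₀ - ρ ^ 2) t₀)).prod (volume.restrict (ball y ρ)) := by
      rw [hQeq, Measure.volume_eq_prod, Measure.prod_restrict]
    have hprodI : ∀ R : ℝ, (volume.restrict (Ioo 0 t₀ ×ˢ ball y R) : Measure (ℝ × EuclideanSpace ℝ (Fin 3))) =
        (volume.restrict (Ioo 0 t₀)).prod (volume.restrict (ball y R)) := fun R => by
      rw [Measure.volume_eq_prod, Measure.prod_restrict]
    have hu' : IsLocalLeraySolutionOn t₀ 1 u₀ u p := hu.mono ht₀T'.le
    have hvolball : volume (ball y ρ) = ENNReal.ofReal (ρ ^ 3) * V₁ := by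
      rw [Measure.addHaar_ball volume y hρ.le, finrank_euclideanSpace_fin, hV₁]
    have hvolI : volume (Ioo (t₀ - ρ ^ 2) t₀) = ENNReal.ofReal (ρ ^ 2) := by
      rw [Real.volume_Ioo]; congr 1; ring
    have hρs5 : ENNReal.ofReal (ρ ^ 3) * ENNReal.ofReal (ρ ^ 2) ≤ ENNReal.ofReal (s ^ 5) := by
      rw [← ENNReal.ofReal_mul (by positivity)]
      refine ENNReal.ofReal_le_ofReal ?_
      rw [hρdef]
      have := hs.le
      nlinarith [pow_pos hs 5]
    -- ### the near field
    have hnear_slice : ∀ᵐ t ∂(volume.restrict (Ioo 0 t₀)),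
        ∫⁻ x, ‖localPressureNear y ρ u t x‖ₑ ^ (3 / 2 : ℝ) ≤ Cn * ∫⁻ x in ball y (2 * ρ), ‖u t x‖ₑ ^ (3 : ℕ) := by
      filter_upwards [hu'.ae_aestronglyMeasurable_slice', hu'.ae_lintegral_cube_ball_lt_top y (2 * ρ)] with t hm hc3
      exact hCn y ρ u t hm hc3.ne
    have hNQ : ∫⁻ z in Q, ‖localPressureNear y ρ u z.1 z.2‖ₑ ^ (3 / 2 : ℝ) ≤
        Cn * (4 * ENNReal.ofReal (8 * A ^ 3) * V₁ * ENNReal.ofReal (t₀ * (2 * ρ) ^ 3) +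
          8 * Kc * (Λ : ℝ≥0∞) ^ (3 / 2 : ℝ) * ENNReal.ofReal (s ^ 5)) := by
      have hTon : ∫⁻ t in Ioo 0 t₀, ∫⁻ x in ball y (2 * ρ), ‖u t x‖ₑ ^ (3 : ℕ) =
          ∫⁻ z in Ioo 0 t₀ ×ˢ ball y (2 * ρ), ‖u z.1 z.2‖ₑ ^ (3 : ℕ) := by
        have hf : AEMeasurable (fun z : ℝ × EuclideanSpace ℝ (Fin 3) => ‖u z.1 z.2‖ₑ ^ (3 : ℕ))
            ((volume.restrict (Ioo 0 t₀)).prod (volume.restrict (ball y (2 * ρ)))) := by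
          rw [← hprodI]; exact (humR (2 * ρ)).aemeasurable.enorm.pow_const _
        rw [hprodI, lintegral_prod _ hf]
      calc ∫⁻ z in Q, ‖localPressureNear y ρ u z.1 z.2‖ₑ ^ (3 / 2 : ℝ)
          = ∫⁻ z, ‖localPressureNear y ρ u z.1 z.2‖ₑ ^ (3 / 2 : ℝ) ∂((volume.restrict (Ioo (t₀ - ρ ^ 2) t₀)).prod (volume.restrict (ball y ρ))) := by
            rw [hprodQ]
        _ ≤ ∫⁻ t in Ioo (t₀ - ρ ^ 2) t₀, ∫⁻ x in ball y ρ, ‖localPressureNear y ρ u t x‖ₑ ^ (3 / 2 : ℝ) := lintegral_prod_le _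
        _ ≤ ∫⁻ t in Ioo (t₀ - ρ ^ 2) t₀, ∫⁻ x, ‖localPressureNear y ρ u t x‖ₑ ^ (3 / 2 : ℝ) :=
            lintegral_mono fun t => setLIntegral_le_lintegral _ _
        _ ≤ ∫⁻ t in Ioo 0 t₀, ∫⁻ x, ‖localPressureNear y ρ u t x‖ₑ ^ (3 / 2 : ℝ) := lintegral_mono_set hIQ
        _ ≤ ∫⁻ t in Ioo 0 t₀, Cn * ∫⁻ x in ball y (2 * ρ), ‖u t x‖ₑ ^ (3 : ℕ) := lintegral_mono_ae hnear_slice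
        _ = Cn * ∫⁻ z in Ioo 0 t₀ ×ˢ ball y (2 * ρ), ‖u z.1 z.2‖ₑ ^ (3 : ℕ) := by
            rw [lintegral_const_mul' _ _ hCnt, hTon]
        _ ≤ _ := mul_le_mul' le_rfl (hcubeU (by positivity) (by rw [h2ρ]; exact hsr))
    -- ### the far field
    have ht032 : t₀ ^ (3 / 2 : ℝ) = s ^ 3 := by
      rw [← hs2, ← Real.rpow_natCast, ← Real.rpow_mul hs.le, ← Real.rpow_natCast]; norm_num
    have hfar_pt : ∀ᵐ t ∂(volume.restrict (Ioo 0 t₀)), ∀ x ∈ ball y ρ, ‖localPressureFar y ρ u t x‖ₑ ≤ Finf := by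
      filter_upwards [hu'.ae_aestronglyMeasurable_slice', hEv, ae_restrict_of_ae_restrict_of_subset hIT' hαu,
        ae_restrict_mem measurableSet_Ioo] with t hm hEt hαt htI x hx
      have htS₂ : t ∈ Ioo (0 : ℝ) S₂ := hIS₂ htI
      -- `|u|² ≤ 8A² + 2|v|²`
      have hsq : ∀ w ∈ ball y (3 / 1024), ‖u t w‖ₑ ^ (2 : ℕ) ≤ ENNReal.ofReal (8 * A ^ 2) + 2 * ‖u t w - a t w‖ₑ ^ 2 := by
        intro w _
        have hle : ‖u t w‖ₑ ≤ ENNReal.ofReal (2 * A) + ‖u t w - a t w‖ₑ := by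
          have e : u t w = a t w + (u t w - a t w) := by abel
          calc ‖u t w‖ₑ = ‖a t w + (u t w - a t w)‖ₑ := by rw [← e]
            _ ≤ ‖a t w‖ₑ + ‖u t w - a t w‖ₑ := enorm_add_le _ _
            _ ≤ ENNReal.ofReal (2 * A) + ‖u t w - a t w‖ₑ := by
                gcongr; rw [← ofReal_norm]; exact ENNReal.ofReal_le_ofReal (hbd t htS₂ w)
        have h8 : 2 * ENNReal.ofReal (2 * A) ^ 2 = ENNReal.ofReal (8 * A ^ 2) := by
          rw [← ENNReal.ofReal_pow (by positivity), ← ENNReal.ofReal_ofNat, ← ENNReal.ofReal_mul zero_le_two]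
          congr 1; ring
        calc ‖u t w‖ₑ ^ (2 : ℕ) ≤ (ENNReal.ofReal (2 * A) + ‖u t w - a t w‖ₑ) ^ 2 := by gcongr
          _ ≤ 2 * ENNReal.ofReal (2 * A) ^ 2 + 2 * ‖u t w - a t w‖ₑ ^ 2 := PoincareBall.add_sq_le_two_mul_sq_add _ _
          _ = ENNReal.ofReal (8 * A ^ 2) + 2 * ‖u t w - a t w‖ₑ ^ 2 := by rw [h8]
      -- the tail outside `B_{3/1024}(y)`
      have hTL : ∫⁻ w in (ball y (3 / 1024))ᶜ, ‖u t w‖ₑ ^ (2 : ℕ) * RieszKernel.powKer 4 (w - y) ≤ τK := by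
        have hαr : ∀ z : EuclideanSpace ℝ (Fin 3), ∫⁻ w in ball z (3 / 2048), ‖u t w‖ₑ ^ (2 : ℕ) ≤ αu := fun z =>
          (lintegral_mono_set (ball_subset_ball (by norm_num))).trans (hαt z)
        have h := hKtail (fun w => ‖u t w‖ₑ ^ (2 : ℕ)) (hm.enorm.pow_const _) αu hαr y (3 / 1024) (by norm_num)
        simp_rw [powKer_four_eq_ofReal_inv]
        exact h
      have htail := far_tail_le (U := u t) (V := fun w => u t w - a t w) (Cc := ENNReal.ofReal (8 * A ^ 2))
        (EV := (Λ : ℝ≥0∞) * ENNReal.ofReal (t₀ ^ (3 / 2 : ℝ))) (TL := τK) hρ (by linarith [hρr]) hsq hEt hTL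
      refine (enorm_localPressureFar_le hCK0 hCK y hρ u t hx).trans ?_
      refine (mul_le_mul' le_rfl htail).trans ?_
      -- the three terms
      have hCKρ : 0 ≤ CK * ρ := by positivity
      have T1 : ENNReal.ofReal (CK * ρ) * (ENNReal.ofReal (8 * A ^ 2) * ENNReal.ofReal ((2 * ρ)⁻¹ * I4)) =
          ENNReal.ofReal (4 * CK * A ^ 2 * I4) := by
        rw [← ENNReal.ofReal_mul (by positivity), ← ENNReal.ofReal_mul hCKρ]
        congr 1
        field_simp
        ring
      have T2 : ENNReal.ofReal (CK * ρ) * (2 * ENNReal.ofReal ((2 * ρ) ^ (-(4 : ℝ))) * ((Λ : ℝ≥0∞) * ENNReal.ofReal (t₀ ^ (3 / 2 : ℝ)))) =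
          (Λ : ℝ≥0∞) * ENNReal.ofReal CK := by
        have hreal : CK * ρ * (2 * (2 * ρ) ^ (-(4 : ℝ)) * t₀ ^ (3 / 2 : ℝ)) = CK := by
          rw [ht032, h2ρ, hρdef, Real.rpow_neg hs.le, show (4 : ℝ) = ((4 : ℕ) : ℝ) by norm_num, Real.rpow_natCast]
          field_simp
        calc ENNReal.ofReal (CK * ρ) * (2 * ENNReal.ofReal ((2 * ρ) ^ (-(4 : ℝ))) * ((Λ : ℝ≥0∞) * ENNReal.ofReal (t₀ ^ (3 / 2 : ℝ))))
            = (Λ : ℝ≥0∞) * (ENNReal.ofReal (CK * ρ) * (ENNReal.ofReal 2 * ENNReal.ofReal ((2 * ρ) ^ (-(4 : ℝ))) *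
                ENNReal.ofReal (t₀ ^ (3 / 2 : ℝ)))) := by rw [ENNReal.ofReal_ofNat]; ring
          _ = (Λ : ℝ≥0∞) * ENNReal.ofReal (CK * ρ * (2 * (2 * ρ) ^ (-(4 : ℝ)) * t₀ ^ (3 / 2 : ℝ))) := by
              rw [← ENNReal.ofReal_mul zero_le_two, ← ENNReal.ofReal_mul (by positivity), ← ENNReal.ofReal_mul hCKρ]
          _ = (Λ : ℝ≥0∞) * ENNReal.ofReal CK := by rw [hreal]
      have T3 : ENNReal.ofReal (CK * ρ) * τK ≤ ENNReal.ofReal CK * τK := by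
        gcongr
        calc CK * ρ ≤ CK * 1 := mul_le_mul_of_nonneg_left hρ1 hCK0
          _ = CK := mul_one _
      calc ENNReal.ofReal (CK * ρ) * (ENNReal.ofReal (8 * A ^ 2) * ENNReal.ofReal ((2 * ρ)⁻¹ * I4) +
            2 * ENNReal.ofReal ((2 * ρ) ^ (-(4 : ℝ))) * ((Λ : ℝ≥0∞) * ENNReal.ofReal (t₀ ^ (3 / 2 : ℝ))) + τK)
          = ENNReal.ofReal (CK * ρ) * (ENNReal.ofReal (8 * A ^ 2) * ENNReal.ofReal ((2 * ρ)⁻¹ * I4)) +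
            ENNReal.ofReal (CK * ρ) * (2 * ENNReal.ofReal ((2 * ρ) ^ (-(4 : ℝ))) * ((Λ : ℝ≥0∞) * ENNReal.ofReal (t₀ ^ (3 / 2 : ℝ)))) +
            ENNReal.ofReal (CK * ρ) * τK := by ring
        _ ≤ ENNReal.ofReal (4 * CK * A ^ 2 * I4) + (Λ : ℝ≥0∞) * ENNReal.ofReal CK + ENNReal.ofReal CK * τK := by
            rw [T1, T2]; exact add_le_add le_rfl T3
    have hFQ : ∫⁻ z in Q, ‖localPressureFar y ρ u z.1 z.2‖ₑ ^ (3 / 2 : ℝ) ≤ Finf ^ (3 / 2 : ℝ) * V₁ * ENNReal.ofReal (s ^ 5) := by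
      have hslice : ∀ᵐ t ∂(volume.restrict (Ioo (t₀ - ρ ^ 2) t₀)),
          ∫⁻ x in ball y ρ, ‖localPressureFar y ρ u t x‖ₑ ^ (3 / 2 : ℝ) ≤ Finf ^ (3 / 2 : ℝ) * volume (ball y ρ) := by
        filter_upwards [ae_restrict_of_ae_restrict_of_subset hIQ hfar_pt] with t ht
        calc ∫⁻ x in ball y ρ, ‖localPressureFar y ρ u t x‖ₑ ^ (3 / 2 : ℝ)
            ≤ ∫⁻ x in ball y ρ, Finf ^ (3 / 2 : ℝ) := setLIntegral_mono' measurableSet_ball fun x hx =>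
              ENNReal.rpow_le_rpow (ht x hx) (by norm_num)
          _ = Finf ^ (3 / 2 : ℝ) * volume (ball y ρ) := setLIntegral_const _ _
      calc ∫⁻ z in Q, ‖localPressureFar y ρ u z.1 z.2‖ₑ ^ (3 / 2 : ℝ)
          = ∫⁻ z, ‖localPressureFar y ρ u z.1 z.2‖ₑ ^ (3 / 2 : ℝ) ∂((volume.restrict (Ioo (t₀ - ρ ^ 2) t₀)).prod (volume.restrict (ball y ρ))) := by
            rw [hprodQ]
        _ ≤ ∫⁻ t in Ioo (t₀ - ρ ^ 2) t₀, ∫⁻ x in ball y ρ, ‖localPressureFar y ρ u t x‖ₑ ^ (3 / 2 : ℝ) := lintegral_prod_le _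
        _ ≤ ∫⁻ t in Ioo (t₀ - ρ ^ 2) t₀, Finf ^ (3 / 2 : ℝ) * volume (ball y ρ) := lintegral_mono_ae hslice
        _ = Finf ^ (3 / 2 : ℝ) * volume (ball y ρ) * volume (Ioo (t₀ - ρ ^ 2) t₀) := by
            rw [lintegral_const, Measure.restrict_apply_univ]
        _ = Finf ^ (3 / 2 : ℝ) * V₁ * (ENNReal.ofReal (ρ ^ 3) * ENNReal.ofReal (ρ ^ 2)) := by rw [hvolball, hvolI]; ring
        _ ≤ Finf ^ (3 / 2 : ℝ) * V₁ * ENNReal.ofReal (s ^ 5) := mul_le_mul' le_rfl hρs5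
    -- ### the gauged pressure on `Q`
    have hFm : AEMeasurable (fun z : ℝ × EuclideanSpace ℝ (Fin 3) => ‖localPressureFar y ρ u z.1 z.2‖ₑ ^ (3 / 2 : ℝ))
        (volume.restrict Q) := by
      have h := hu.aestronglyMeasurable_localPressureFar y ρ
      have hle : (volume.restrict Q : Measure (ℝ × EuclideanSpace ℝ (Fin 3))) ≤
          ((volume : Measure ℝ).restrict (Ioo 0 T')).prod (volume : Measure (EuclideanSpace ℝ (Fin 3))) := by
        rw [Measure.restrict_prod_eq_prod_univ, ← Measure.volume_eq_prod]
        exact Measure.restrict_mono (hQT'.trans (Set.prod_mono Subset.rfl (subset_univ _))) le_rfl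
      exact ((h.mono_measure hle).aemeasurable.enorm.pow_const _)
    have hpq : ∀ᵐ z ∂(volume.restrict Q), ‖p z.1 z.2 - c z.1‖ₑ ^ (3 / 2 : ℝ) ≤
        s2 * (‖localPressureNear y ρ u z.1 z.2‖ₑ ^ (3 / 2 : ℝ) + ‖localPressureFar y ρ u z.1 z.2‖ₑ ^ (3 / 2 : ℝ)) := by
      filter_upwards [ae_restrict_of_ae_restrict_of_subset hQT' hdecomp] with z hz
      have e : p z.1 z.2 - c z.1 = localPressureNear y ρ u z.1 z.2 + localPressureFar y ρ u z.1 z.2 := by rw [hz]; ring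
      rw [e]
      calc ‖localPressureNear y ρ u z.1 z.2 + localPressureFar y ρ u z.1 z.2‖ₑ ^ (3 / 2 : ℝ)
          ≤ (‖localPressureNear y ρ u z.1 z.2‖ₑ + ‖localPressureFar y ρ u z.1 z.2‖ₑ) ^ (3 / 2 : ℝ) :=
            ENNReal.rpow_le_rpow (enorm_add_le _ _) (by norm_num)
        _ ≤ _ := add_rpow_threeHalves_le _ _
    have hPQ : ∫⁻ z in Q, ‖p z.1 z.2 - c z.1‖ₑ ^ (3 / 2 : ℝ) ≤
        s2 * (Cn * (4 * ENNReal.ofReal (8 * A ^ 3) * V₁ * ENNReal.ofReal (t₀ * (2 * ρ) ^ 3) +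
          8 * Kc * (Λ : ℝ≥0∞) ^ (3 / 2 : ℝ) * ENNReal.ofReal (s ^ 5)) + Finf ^ (3 / 2 : ℝ) * V₁ * ENNReal.ofReal (s ^ 5)) := by
      calc ∫⁻ z in Q, ‖p z.1 z.2 - c z.1‖ₑ ^ (3 / 2 : ℝ)
          ≤ ∫⁻ z in Q, s2 * (‖localPressureNear y ρ u z.1 z.2‖ₑ ^ (3 / 2 : ℝ) + ‖localPressureFar y ρ u z.1 z.2‖ₑ ^ (3 / 2 : ℝ)) :=
            lintegral_mono_ae hpq
        _ = s2 * ((∫⁻ z in Q, ‖localPressureNear y ρ u z.1 z.2‖ₑ ^ (3 / 2 : ℝ)) +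
              ∫⁻ z in Q, ‖localPressureFar y ρ u z.1 z.2‖ₑ ^ (3 / 2 : ℝ)) := by
            rw [lintegral_const_mul' _ _ hs2t, lintegral_add_right' _ hFm]
        _ ≤ _ := mul_le_mul' le_rfl (add_le_add hNQ hFQ)
    -- ### the smallness on `Q`
    have humQ : AEMeasurable (fun z : ℝ × EuclideanSpace ℝ (Fin 3) => ‖u z.1 z.2‖ₑ ^ (3 : ℕ)) (volume.restrict Q) :=
      ((humR ρ).mono_measure (Measure.restrict_mono hQsub le_rfl)).aemeasurable.enorm.pow_const _
    have hUQ : ∫⁻ z in Q, ‖u z.1 z.2‖ₑ ^ (3 : ℕ) ≤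
        4 * ENNReal.ofReal (8 * A ^ 3) * V₁ * ENNReal.ofReal (t₀ * ρ ^ 3) + 8 * Kc * (Λ : ℝ≥0∞) ^ (3 / 2 : ℝ) * ENNReal.ofReal (s ^ 5) :=
      (lintegral_mono_set hQsub).trans (hcubeU hρ.le hρr)
    have ht₀ρ : ENNReal.ofReal (t₀ * ρ ^ 3) ≤ ENNReal.ofReal (s ^ 5) := by
      refine ENNReal.ofReal_le_ofReal ?_
      rw [← hs2, hρdef]; have := hs.le; nlinarith [pow_pos hs 5]
    have ht₀2ρ : ENNReal.ofReal (t₀ * (2 * ρ) ^ 3) = ENNReal.ofReal (s ^ 5) := by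
      rw [h2ρ, ← hs2]; ring_nf
    have htotal : ∫⁻ z in Q, (‖u z.1 z.2‖ₑ ^ (3 : ℕ) + ‖p z.1 z.2 - c z.1‖ₑ ^ (3 / 2 : ℝ)) ≤ Ktot * ENNReal.ofReal (s ^ 5) := by
      rw [lintegral_add_left' humQ]
      refine (add_le_add hUQ hPQ).trans ?_
      rw [ht₀2ρ]
      calc 4 * ENNReal.ofReal (8 * A ^ 3) * V₁ * ENNReal.ofReal (t₀ * ρ ^ 3) + 8 * Kc * (Λ : ℝ≥0∞) ^ (3 / 2 : ℝ) * ENNReal.ofReal (s ^ 5) +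
            s2 * (Cn * (4 * ENNReal.ofReal (8 * A ^ 3) * V₁ * ENNReal.ofReal (s ^ 5) +
              8 * Kc * (Λ : ℝ≥0∞) ^ (3 / 2 : ℝ) * ENNReal.ofReal (s ^ 5)) + Finf ^ (3 / 2 : ℝ) * V₁ * ENNReal.ofReal (s ^ 5))
          ≤ 4 * ENNReal.ofReal (8 * A ^ 3) * V₁ * ENNReal.ofReal (s ^ 5) + 8 * Kc * (Λ : ℝ≥0∞) ^ (3 / 2 : ℝ) * ENNReal.ofReal (s ^ 5) +
            s2 * (Cn * (4 * ENNReal.ofReal (8 * A ^ 3) * V₁ * ENNReal.ofReal (s ^ 5) +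
              8 * Kc * (Λ : ℝ≥0∞) ^ (3 / 2 : ℝ) * ENNReal.ofReal (s ^ 5)) + Finf ^ (3 / 2 : ℝ) * V₁ * ENNReal.ofReal (s ^ 5)) := by
            gcongr
        _ = Ktot * ENNReal.ofReal (s ^ 5) := by simp only [hKtot, hB₀]; ring
    have hsmall : ∫⁻ z in Q, (‖u z.1 z.2‖ₑ ^ (3 : ℕ) + ‖p z.1 z.2 - c z.1‖ₑ ^ (3 / 2 : ℝ)) ≤
        ENNReal.ofReal ((L * s) ^ 3 * ρ ^ 2) := by
      refine htotal.trans (le_of_eq ?_)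
      rw [← ENNReal.ofReal_toReal hKtott, ← ENNReal.ofReal_mul ENNReal.toReal_nonneg]
      congr 1
      rw [mul_pow, hL3, hρdef]
      ring
    -- ### the criterion
    have hres := Hckn hu hcL t₀ y ρ (L * s) hρ hρt ht₀T' (by positivity) hsε hsmall
    filter_upwards [hres] with w hw
    calc ‖u w.1 w.2‖ ≤ C₀ * (L * s) / ρ := hw
      _ = 2 * C₀ * L := by rw [hρdef]; field_simp
  -- ## the covering of `(0, T) × B_{1/2}(x₀)` by half-cylinders
  obtain ⟨D₁, hD₁c, hD₁d⟩ := TopologicalSpace.exists_countable_dense ℝ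
  obtain ⟨D₃, hD₃c, hD₃d⟩ := TopologicalSpace.exists_countable_dense (EuclideanSpace ℝ (Fin 3))
  set Tm : ℝ := min T₂ T₀ with hTm
  have hTmpos : 0 < Tm := lt_min hT₂pos hT₀
  set S : Set (ℝ × EuclideanSpace ℝ (Fin 3)) :=
    {q | q ∈ D₁ ×ˢ D₃ ∧ 0 < q.1 ∧ q.1 < Tm ∧ q.2 ∈ ball x₀ R₀} with hSdef
  have hSc : S.Countable := (hD₁c.prod hD₃c).mono fun q hq => hq.1
  have hU : ∀ᵐ w ∂(volume.restrict (⋃ q ∈ S, parabolicCylinder (Real.sqrt q.1 / 2 / 2) ((q.1 : ℝ), q.2))),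
      ‖u w.1 w.2‖ ≤ 2 * C₀ * L := by
    rw [ae_restrict_biUnion_iff _ hSc]
    rintro ⟨t₀, y⟩ ⟨-, ht₀, ht₀T, hy⟩
    exact hcyl t₀ y ht₀ ht₀T hy
  refine ae_restrict_of_ae_restrict_of_subset ?_ hU
  rintro ⟨t, x⟩ ⟨ht, hx⟩
  have ht1 : t < 16 * t / 15 := by linarith [ht.1]
  have ht2 : t < Tm := ht.2
  -- a top `t₀ ∈ D₁` with `t < t₀ < min (16t/15) Tm`
  obtain ⟨t₀, ht₀D, ht₀I⟩ := hD₁d.exists_mem_open isOpen_Ioo (nonempty_Ioo.2 (lt_min ht1 ht2))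
  have ht₀pos : 0 < t₀ := ht.1.trans ht₀I.1
  have ht₀Tm : t₀ < Tm := ht₀I.2.trans_le (min_le_right _ _)
  have ht₀t : 15 * t₀ / 16 < t := by
    have := ht₀I.2.trans_le (min_le_left _ _)
    linarith
  -- a centre `y ∈ D₃` close to `x` inside `B_{R₀}(x₀)`
  have hgap : 0 < R₀ - dist x x₀ := by rw [mem_ball] at hx; linarith
  have hrad : 0 < min (Real.sqrt t₀ / 2 / 2) (R₀ - dist x x₀) := lt_min (by positivity) hgap
  obtain ⟨y, hyD, hyB⟩ := hD₃d.exists_mem_open isOpen_ball ⟨x, mem_ball_self hrad⟩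
  rw [mem_ball] at hyB
  have hyx : dist x y < Real.sqrt t₀ / 2 / 2 := by rw [dist_comm]; exact hyB.trans_le (min_le_left _ _)
  have hy₀ : y ∈ ball x₀ R₀ := by
    rw [mem_ball]
    calc dist y x₀ ≤ dist y x + dist x x₀ := dist_triangle _ _ _
      _ < (R₀ - dist x x₀) + dist x x₀ := by gcongr; exact hyB.trans_le (min_le_right _ _)
      _ = R₀ := by ring
  refine mem_iUnion₂.2 ⟨(t₀, y), ⟨⟨ht₀D, hyD⟩, ht₀pos, ht₀Tm, hy₀⟩, ?_⟩
  rw [mem_parabolicCylinder]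
  refine ⟨⟨?_, ht₀I.1⟩, hyx⟩
  have hsq : (Real.sqrt t₀ / 2 / 2) ^ 2 = t₀ / 16 := by
    rw [div_pow, div_pow, Real.sq_sqrt ht₀pos.le]; ring
  show t₀ - (Real.sqrt t₀ / 2 / 2) ^ 2 < t
  rw [hsq]; linarith

end JiaSverak2014

end Literature.Analysis.FluidPDE

end
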